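import Literature.AlgebraicGeometry.Resolution.DerivativeIdeals
import Mathlib.RingTheory.Etale.Kaehler
import Mathlib.Algebra.Module.FinitePresentation
import HarnessLib

/-!
# Derivative ideals commute with localization

Topic: `Literature/AlgebraicGeometry/Resolution`. PROVED (the algebra behind the sheaf `𝒟(𝓘)`
of Bierstone–Grigoriev–Milman–Włodarczyk, *Effective Hironaka resolution and its complexity*,
arXiv:1206.3090, Def. 3.5.1: "`𝒟(𝓘)` is the **coherent** sheaf of ideals on the smooth variety
`X` locally generated by `f ∈ 𝓘` and their first derivatives"): for a `k`-algebra `A`, a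
localization `A → S = M⁻¹A` and an ideal `I ⊆ A`,

* `exists_derivation_extend_of_isLocalization` — every `k`-derivation `δ` of `A` **extends** to a
  `k`-derivation `δ'` of `S` (`δ'(a/1) = δ(a)/1`; via `Ω[S⁄k] = S ⊗_A Ω[A⁄k]`,
  `KaehlerDifferential.isLocalizedModule_map`);
* `map_derivIdeal_le_of_isLocalization` — hence `𝒟(I)·S ⊆ 𝒟(I·S)` (always);
* `exists_derivation_restrict_of_isLocalization` — if `Ω[A⁄k]` is a finitely presented
  `A`-module (e.g. `A` of finite presentation over `k`), every `k`-derivation `δ'` of `S`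
  **restricts**, up to a denominator `m ∈ M`, to a derivation `δ` of `A`:
  `δ(a)/1 = m · δ'(a/1)` (`Module.FinitePresentation.exists_lift_of_isLocalizedModule`);
* `derivIdeal_map_of_isLocalization` — hence **`𝒟(I·S) = 𝒟(I)·S`**: the derivative ideal of
  `DerivativeIdeals.lean` commutes with localization, so that `U ↦ 𝒟(𝓘(U))` is a quasi-coherent
  ideal sheaf on a `k`-scheme locally of finite presentation (`DerivativeIdealSheaf.lean`);
* `derivIdealIter_map_of_isLocalization` — the same for `𝒟ⁱ`.

## Sources

* [BGMW 2011] Def. 3.5.1 (p. 7, arXiv numbering). [BierstoneGrigorievMilmanWlodarczyk2011]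
-/

namespace Literature.AlgebraicGeometry.Resolution

open KaehlerDifferential

universe u v w

section Localization

variable (k : Type u) [CommRing k] {A : Type v} [CommRing A] [Algebra k A]
  (S : Type w) [CommRing S] [Algebra A S] [Algebra k S] [IsScalarTower k A S]
  (M : Submonoid A) [IsLocalization M S]

include M

/-- **Derivations extend to localizations**: for a `k`-derivation `δ` of `A` there is a
`k`-derivation `δ'` of `S = M⁻¹A` with `δ'(a/1) = δ(a)/1` (namely `δ'(a/s) = (δ(a)s - aδ(s))/s²`;
here obtained from `Ω[S⁄k] = M⁻¹Ω[A⁄k]`; cf. the module-valued formally-étale version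
`Literature.NumberTheory.Transcendental.exists_derivation_extend_of_formallyEtale` of `NumberTheory/Transcendental`). [folklore] -/
theorem exists_derivation_extend_of_isLocalization (δ : Derivation k A A) :
    ∃ δ' : Derivation k S S, ∀ a : A, δ' (algebraMap A S a) = algebraMap A S (δ a) := by
  let ℓ : Ω[A⁄k] →ₗ[A] A := δ.liftKaehlerDifferential
  let ℓ' : Ω[S⁄k] →ₗ[S] S :=
    IsLocalizedModule.mapExtendScalars M (KaehlerDifferential.map k k A S)
      (Algebra.linearMap A S) S ℓ
  refine ⟨ℓ'.compDer (KaehlerDifferential.D k S), fun a => ?_⟩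
  change ℓ' (KaehlerDifferential.D k S (algebraMap A S a)) = _
  rw [← KaehlerDifferential.map_D k k A S a]
  change IsLocalizedModule.map M (KaehlerDifferential.map k k A S) (Algebra.linearMap A S) ℓ
    (KaehlerDifferential.map k k A S (KaehlerDifferential.D k A a)) = _
  rw [IsLocalizedModule.map_apply]
  change algebraMap A S (ℓ (KaehlerDifferential.D k A a)) = _
  rw [Derivation.liftKaehlerDifferential_comp_D]

/-- **`𝒟(I)·S ⊆ 𝒟(I·S)`** for a localization `S` of `A` (derivatives of elements of `I` are
values of the extended derivations on `I·S`). [cite: BierstoneGrigorievMilmanWlodarczyk2011, Def. 3.5.1] -/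
theorem map_derivIdeal_le_of_isLocalization (I : Ideal A) :
    (derivIdeal k I).map (algebraMap A S) ≤ derivIdeal k (I.map (algebraMap A S)) := by
  rw [Ideal.map_le_iff_le_comap, derivIdeal_le_iff]
  refine ⟨fun f hf => ?_, fun δ f hf => ?_⟩
  · exact Ideal.mem_comap.mpr ((le_derivIdeal k _) (Ideal.mem_map_of_mem _ hf))
  · obtain ⟨δ', hδ'⟩ := exists_derivation_extend_of_isLocalization k S M δ
    rw [Ideal.mem_comap, ← hδ']
    exact apply_mem_derivIdeal k δ' (Ideal.mem_map_of_mem _ hf)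

/-- **Derivations of a localization restrict, up to a denominator**: if `Ω[A⁄k]` is finitely
presented, then for every `k`-derivation `δ'` of `S = M⁻¹A` there are a `k`-derivation `δ` of `A`
and `m ∈ M` with `δ(a)/1 = m · δ'(a/1)` for all `a ∈ A` (`Hom_A(Ω[A⁄k], –)` commutes with
localization for finitely presented `Ω[A⁄k]`). [folklore] -/
theorem exists_derivation_restrict_of_isLocalization [Module.FinitePresentation A Ω[A⁄k]]
    (δ' : Derivation k S S) :
    ∃ (δ : Derivation k A A) (m : M), ∀ a : A,
      algebraMap A S (δ a) = algebraMap A S m * δ' (algebraMap A S a) := by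
  -- the `A`-linear map `Ω[A⁄k] → Ω[S⁄k] → S` induced by `δ'`
  let g : Ω[A⁄k] →ₗ[A] S :=
    (δ'.liftKaehlerDifferential.restrictScalars A) ∘ₗ (KaehlerDifferential.map k k A S)
  obtain ⟨h, m, hh⟩ :=
    Module.FinitePresentation.exists_lift_of_isLocalizedModule M (Algebra.linearMap A S) g
  refine ⟨h.compDer (KaehlerDifferential.D k A), m, fun a => ?_⟩
  have h1 : algebraMap A S (h (KaehlerDifferential.D k A a)) =
      (m • g) (KaehlerDifferential.D k A a) := by
    rw [← hh]; rfl
  have h2 : (m • g) (KaehlerDifferential.D k A a) = (m : A) • δ' (algebraMap A S a) := by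
    rw [LinearMap.smul_apply]
    change m • δ'.liftKaehlerDifferential (KaehlerDifferential.map k k A S
      (KaehlerDifferential.D k A a)) = _
    rw [KaehlerDifferential.map_D, Derivation.liftKaehlerDifferential_comp_D]
    rfl
  change algebraMap A S (h (KaehlerDifferential.D k A a)) = _
  rw [h1, h2, Algebra.smul_def]

/-- **`𝒟` commutes with localization**: `𝒟(I·S) = 𝒟(I)·S` for a localization `S = M⁻¹A` of a
`k`-algebra `A` with finitely presented `Ω[A⁄k]` (BGMW Def. 3.5.1: `𝒟(𝓘)` is a coherent ideal
sheaf, computed locally). [cite: BierstoneGrigorievMilmanWlodarczyk2011, Def. 3.5.1] -/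
theorem derivIdeal_map_of_isLocalization [Module.FinitePresentation A Ω[A⁄k]] (I : Ideal A) :
    derivIdeal k (I.map (algebraMap A S)) = (derivIdeal k I).map (algebraMap A S) := by
  refine le_antisymm ?_ (map_derivIdeal_le_of_isLocalization k S M I)
  rw [derivIdeal_le_iff]
  refine ⟨Ideal.map_mono (le_derivIdeal k I), fun δ' x hx => ?_⟩
  obtain ⟨δ, m, hδ⟩ := exists_derivation_restrict_of_isLocalization k S M δ'
  -- induction over `x ∈ I·S = span (algebraMap '' I)`
  refine Submodule.span_induction (p := fun x _ => δ' x ∈ (derivIdeal k I).map (algebraMap A S))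
    ?_ ?_ ?_ ?_ hx
  · rintro _ ⟨a, ha, rfl⟩
    -- `δ'(a/1) = (m/1)⁻¹ · δ(a)/1`
    have hu : IsUnit (algebraMap A S m) := IsLocalization.map_units S m
    have heq : δ' (algebraMap A S a) = hu.unit⁻¹ * algebraMap A S (δ a) := by
      rw [hδ a, ← mul_assoc, IsUnit.val_inv_mul, one_mul]
    rw [heq]
    exact Ideal.mul_mem_left _ _ (Ideal.mem_map_of_mem _ (apply_mem_derivIdeal k δ ha))
  · rw [map_zero]; exact zero_mem _
  · intro x y _ _ hx hy
    rw [map_add]; exact add_mem hx hy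
  · intro c x hx' hx
    rw [smul_eq_mul, Derivation.leibniz, smul_eq_mul, smul_eq_mul]
    refine add_mem (Ideal.mul_mem_left _ _ hx) (Ideal.mul_mem_right _ _ ?_)
    exact Ideal.map_mono (le_derivIdeal k I) hx'

/-- `𝒟ⁱ` commutes with localization: `𝒟ⁱ(I·S) = 𝒟ⁱ(I)·S`.
[cite: BierstoneGrigorievMilmanWlodarczyk2011, Def. 3.5.1] -/
theorem derivIdealIter_map_of_isLocalization [Module.FinitePresentation A Ω[A⁄k]] (i : ℕ)
    (I : Ideal A) :
    derivIdealIter k i (I.map (algebraMap A S)) = (derivIdealIter k i I).map (algebraMap A S) := by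
  induction i with
  | zero => rfl
  | succ i ih =>
    rw [derivIdealIter_succ, derivIdealIter_succ, ih, derivIdeal_map_of_isLocalization k S M]

/-- Without finite presentation, still `𝒟ⁱ(I)·S ⊆ 𝒟ⁱ(I·S)`.
[cite: BierstoneGrigorievMilmanWlodarczyk2011, Def. 3.5.1] -/
theorem map_derivIdealIter_le_of_isLocalization (i : ℕ) (I : Ideal A) :
    (derivIdealIter k i I).map (algebraMap A S) ≤ derivIdealIter k i (I.map (algebraMap A S)) := by
  induction i with
  | zero => exact le_rfl
  | succ i ih =>
    rw [derivIdealIter_succ, derivIdealIter_succ]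
    exact (map_derivIdeal_le_of_isLocalization k S M _).trans (derivIdeal_mono k ih)

end Localization

end Literature.AlgebraicGeometry.Resolution
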